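import Literature.Probability.LatticeModels.IsoradialPercolation
import HarnessLib

/-!
# The alternating arm events of Grimmett–Manolescu (cluster-separated form)

Companion of `Literature.Probability.Percolation.Isoradial` (crit-perc.S24), placed *below* it
in the import graph: this file imports only the prelude
`Literature.Probability.LatticeModels.IsoradialPercolation` (already imported by `Isoradial`),
so that `Isoradial.lean` can import it — at no cost to the import closure of its large
downstream cone — and state Grimmett–Manolescu's universality of the alternating arm exponents
with the event defined here. (Until 2026-08-15 the direction was the opposite: this file
imported `Isoradial` for the colour sequence `alternatingColours`, now spelled out literally in
`embAltArmEvent_subset_embArmEvent`, its only use, and `IsoradialPercolationProofs` for the two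
folklore walk lemmas bridging induced-subgraph reachability and walks with constrained support,
of which it now keeps private copies; the public declarations are otherwise unchanged.)

Source: Grimmett–Manolescu, *Bond percolation on isoradial graphs: criticality and
universality*, PTRF 159 (2014) 273–327 = arXiv:1204.0505, §3 (arm events) and §8.2 (modified
arm events). §3 (arXiv p. 7): "the arm-event `A_σ(N, n)` is the event that there exist `k`
vertex-disjoint crossings `γ_1, …, γ_k` of `𝒜(N, n)` with colours `σ_i` *taken in anticlockwise
order*"; "`σ` is called alternating if it has even length and either `σ = (1,0,1,0,…)` or
`σ = (0,1,0,1,…)`; when `σ` is alternating with length `k = 2j` the corresponding event is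
denoted `A_{2j}(N, n)`"; Theorem (Universality) (a): "Let `π ∈ {ρ} ∪ {ρ_{2j} : j ≥ 1}`. If `π`
exists for some `G ∈ 𝒢`, then it is `𝒢`-invariant." §8.2 (arXiv p. 23), the modified events
`Ã_k(N, n)`, `k = 2j ≥ 4`: "there exist vertices `x_1, …, x_j ∈ Λ(N)` and `y_1, …, y_j ∉ Λ(n)`
… such that `x_i ↔ y_i` and `x_i ↮ x_{i'}` for `i ≠ i'`"; `k = 2`: "`x_1 ↔ y_1` and
`x_1^* ↔^* y_1^*`"; Proposition (exp_equiv), third display: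
`c₃ P_G[A_k(N, n)] ≤ P_G[Ã_k(N, n)] ≤ c₄ P_G[A_k(N, n)]`.

## Why a second arm event

The prelude's `RhombicEmbedding.embArmEvent κ r R` (`IsoradialPercolation`) asks, for a colour
sequence `κ : Fin k → Bool`, for pairwise vertex-disjoint primal open crossings at the indices
coloured `true` and pairwise disjoint dual-open crossings at the indices coloured `false`, and —
as its docstring says — imposes **no cyclic order**. For the alternating sequence of length
`2j`, `j ≥ 2`, that is a strictly larger event than `A_{2j}`: on `ℤ²`, open all edges in the
left half of the annulus and close all edges in the right half; there are `j` disjoint open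
crossings on the left and `j` disjoint dual crossings on the right (cyclic pattern `1…10…0`),
but a single open crossing cluster, so `A_{2j}` fails — `embArmEvent (alternating)` is the union
over all cyclic arrangements `τ` of `j` ones and `j` zeros of the polychromatic events `A_τ`
(an explicit finite witness on `√2 ℤ²`, the "ladder" configuration, is in
`IsoradialPrintedArms`: `embAltArmEvent_two_ssubset_embArmEvent`). GM's theorem says nothing
about non-alternating `τ` (for general colour sequences existence and invariance of `ρ(σ, G)`
is the paper's Conjecture, §3; for bond percolation on isoradial graphs no colour-switching is
available), and its proof does not cover the larger event: it transports arm events along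
star–triangle moves in the *cluster* form `x_i ↔ y_i`, `x_i ↮ x_{i'}` of the modified events
`Ã_{2j}` (§8.2; proof of the Lemma of §8.3: "these clusters neither break nor merge"), which is
equivalent to cyclic alternation up to constants (Proposition (exp_equiv)) but not to
vertex-disjointness of arms of one colour. For `j = 1` the two events agree (two arms of
different colours are always "alternating in anticlockwise order"):
`RhombicEmbedding.embArmEvent_alternatingColours_one` (`IsoradialArmUniversalityProofs`).

The original transcription of Theorem (Universality) (a), `π = ρ_{2j}`, in `Isoradial.lean`
(`gm_universality_arms`, crit-perc.S24) used `embArmEvent (alternatingColours j)` and, in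
addition, the H21 rendering `RhombicEmbedding.HasSquareGridProperty` of the square-grid
property, strictly weaker than the printed SGP(I) of §4.2 (the track-set *partitioned* as
`S ∪ T₁ ∪ T₂`; "for `s ∈ 𝒯 ∖ T_k`, *every* track of `T_k` intersects `s`", in order; faithful
predicate `RhombicEmbedding.HasSquareGridPropertyGM` of `IsoradialSquareGrid`; the proofs use
clause (b): §7, first paragraph, and §8.4, "since each `r_i` intersects each `s_j`"). Both
discrepancies made the Lean statement **stronger than what the source proves** (verdict of the
`provefact` seat, 2026-08-15: *misstated*); the corrected statement — square-grid property as
printed at `G` and at the witness `G₀`, events `embAltArmEvent j` on both sides, `Countable V`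
and `G.LocallyFinite` bound explicitly — is the restatement in place of `gm_universality_arms`
(same name, same cite; `Isoradial.lean`, whose docstring quotes the superseded body), for
which this file provides the event.

## Contents

* `annulusPts z r R` — the vertices (faces) drawn in the thick annulus
  `{r - 2 ≤ ‖·‖_∞ ≤ R + 2}`; `RhombicEmbedding.dualConnIn` — dual-open connection inside a set
  of faces (the open* analogue of `Percolation.openConnIn`), with its walk formulation.
* `RhombicEmbedding.embAltArmEvent emb j r R` — the alternating `2j`-arm event in the
  cluster-separated form of GM §8.2: `j` open crossings of the annulus `Λ_R ∖ Λ_r` (sup-norm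
  boxes, slack `2`, exactly as in `embArmEvent`) no two of which are joined by an open path of
  the annulus, **and** `j` dual-open crossings no two of which are joined by a dual-open path of
  the annulus. For `j ≥ 2` the first clause alone already forces, by planar duality, a dual
  crossing between any two cyclically consecutive crossing clusters, i.e. the cyclic pattern
  `1, 0, 1, 0, …`; conversely arms alternating in cyclic order are separated by the arms of the
  other colour, which open (dual-open) paths cannot cross, so they lie in distinct (dual)
  clusters of the annulus. For `j = 1` the conjunction is "one primal and one dual crossing"
  `= A_2`. So, up to the slack-`2` rendering of the annulus boundaries shared with `embArmEvent`
  (a configuration in `A_{2j}(r - 2, R + 2)` lies in `embAltArmEvent j r R`: the first and last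
  vertices of an arc crossing the closed annulus are within edge-length `2` of its boundary;
  immaterial for exponents by Proposition (exp_equiv), first two displays: halving `n` or
  doubling `N` changes `P[A_k(N, n)]` by a bounded factor), this is GM's `A_{2j}(r, R)`.
* API: `embAltArmEvent_zero` (`j = 0` gives the sure event) and
  `embAltArmEvent_subset_embArmEvent` (the event is contained in the prelude's event for the
  alternating colour sequence `fun i => decide (Even i)` — `alternatingColours j` of
  `Isoradial.lean`, unfolded —: separated crossings are in particular vertex-disjoint; the
  inclusion is strict for `j ≥ 2`, see above).

What is deliberately not here: no proof of universality (GM §§5–8: star–triangle transport,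
the separation theorem and the box-crossing property of Theorem 3.1 — itself the named fact
`gm_boxCrossingBounds_uniform` of `Isoradial.lean`); no topological proof that `embAltArmEvent`
equals the cyclically ordered arm event (argued above informally; cf. GM §8.2); no named fact.

## References

* G. R. Grimmett, I. Manolescu, *Bond percolation on isoradial graphs: criticality and
  universality*, PTRF 159 (2014) 273–327, arXiv:1204.0505: §3 (arm events `A_σ(N, n)`,
  Theorem (Universality) (a), Conjecture on general `σ`), §4.2 (SGP(I)), §7 (general graphs),
  §8.1 (Proposition: transport of arm-event probabilities), §8.2 (modified arm events `Ã_k`;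
  Proposition: equivalence of arm events), §8.3 (Lemma: isoradial square lattices) and §8.4.
-/

noncomputable section

open MeasureTheory

namespace Literature.Probability.Percolation

open LatticeModels Percolation

/-! ### The annulus and dual connections -/

/-- The vertices (or faces) drawn by `z` in the thick sup-norm annulus
`{r - 2 ≤ ‖·‖_∞ ≤ R + 2}` — the region in which the arms of `RhombicEmbedding.embArmEvent`
(and of `embAltArmEvent` below) live (slack `2`, see the module docstring of
`IsoradialPercolation`). (Grimmett–Manolescu 2014, §3, the annulus `𝒜(N, n)`; H21 rendering.)
[cite: GrimmettManolescu2014Isoradial, §3 (annulus A(N,n))] -/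
def annulusPts {α : Type*} (z : α → ℂ) (r R : ℕ) : Set α :=
  {a | (z a).boxNorm ∈ Set.Icc ((r : ℝ) - 2) (R + 2)}

/-- Unfolding `annulusPts`. [folklore] -/
@[simp] theorem mem_annulusPts {α : Type*} (z : α → ℂ) (r R : ℕ) (a : α) :
    a ∈ annulusPts z r R ↔ (z a).boxNorm ∈ Set.Icc ((r : ℝ) - 2) (R + 2) :=
  Iff.rfl

section Dual

variable {V : Type*} {G : SimpleGraph V} {F : Type*} (emb : RhombicEmbedding G F)

/-- Reachability in the subgraph induced on `S` is witnessed exactly by walks of the ambient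
graph all of whose vertices lie in `S` (Mathlib bookkeeping: `SimpleGraph.Walk.map` along
`SimpleGraph.Embedding.induce S` in one direction, `SimpleGraph.Walk.induce` in the other).
Private copy of `Literature.Probability.LatticeModels.exists_reachable_induce_iff_exists_walk`
(`IsoradialPercolationProofs`), kept here so that this file imports only the prelude
`IsoradialPercolation` (see the module docstring). [folklore] -/
private theorem exists_reachable_induce_iff_exists_walk' {α : Type*} (H : SimpleGraph α)
    (S : Set α) (x y : α) :
    (∃ (hx : x ∈ S) (hy : y ∈ S), (H.induce S).Reachable ⟨x, hx⟩ ⟨y, hy⟩) ↔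
      ∃ w : H.Walk x y, ∀ v ∈ w.support, v ∈ S := by
  constructor
  · rintro ⟨hx, hy, ⟨q⟩⟩
    refine ⟨(q.map (SimpleGraph.Embedding.induce S).toHom).copy rfl rfl, fun v hv => ?_⟩
    rw [SimpleGraph.Walk.support_copy, SimpleGraph.Walk.support_map] at hv
    obtain ⟨u, -, rfl⟩ := List.mem_map.1 hv
    exact u.2
  · rintro ⟨w, hw⟩
    exact ⟨hw x w.start_mem_support, hw y w.end_mem_support, ⟨w.induce S hw⟩⟩

/-- `{x ↔ y in S}` (`Percolation.openConnIn`, reachability in the open graph induced on `S`)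
holds iff some open walk from `x` to `y` has all of its vertices in `S`. Private copy of
`Literature.Probability.LatticeModels.mem_openConnIn_iff_exists_openWalk`
(`IsoradialPercolationProofs`), for the same reason. [folklore] -/
private theorem mem_openConnIn_iff_exists_openWalk' {S : Set V} {x y : V} {ω : BondConfig V} :
    ω ∈ openConnIn S x y ↔ ∃ w : (openGraph ω).Walk x y, ∀ v ∈ w.support, v ∈ S :=
  exists_reachable_induce_iff_exists_walk' _ S x y

/-- The dual analogue of `Percolation.openConnIn`: the faces `f` and `g` are joined by a
*dual-open* path (a walk of `emb.dualOpenGraph ω`, i.e. through dual edges whose primal edge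
is closed) all of whose faces lie in `S`. (Grimmett 1999, §11.2, open dual paths;
Grimmett–Manolescu 2014, §2.2, "open*" connections `u ↔* v`.)
[cite: GrimmettManolescu2014Isoradial, §2.2 (open* paths)] -/
def _root_.Literature.Probability.LatticeModels.RhombicEmbedding.dualConnIn
    (ω : BondConfig V) (S : Set F) (f g : F) : Prop :=
  ∃ (hf : f ∈ S) (hg : g ∈ S), ((emb.dualOpenGraph ω).induce S).Reachable ⟨f, hf⟩ ⟨g, hg⟩

/-- `dualConnIn` holds iff some dual-open walk from `f` to `g` has all of its faces in `S`
(bookkeeping, via the induced-subgraph/walk bridge). [folklore] -/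
theorem _root_.Literature.Probability.LatticeModels.RhombicEmbedding.dualConnIn_iff_exists_walk
    (ω : BondConfig V) (S : Set F) (f g : F) :
    emb.dualConnIn ω S f g ↔
      ∃ w : (emb.dualOpenGraph ω).Walk f g, ∀ v ∈ w.support, v ∈ S :=
  exists_reachable_induce_iff_exists_walk' _ S f g

/-! ### The alternating arm event, cluster-separated form -/

/-- **The alternating `2j`-arm event `A_{2j}(r, R)` of Grimmett–Manolescu, cluster-separated
form.** There are `j` vertices `x_i` drawn in `Λ_r` and `j` vertices `y_i` drawn outside the
open box `(-R, R)²` with `x_i ↔ y_i` *inside the annulus* `{r - 2 ≤ ‖·‖_∞ ≤ R + 2}`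
(`openConnIn`) and `x_i ↮ x_{i'}` inside the annulus for `i ≠ i'` (the `j` open crossings lie
in distinct open clusters of the annulus); and dually `j` faces `f_i` in `Λ_r`, `g_i` outside
`(-R, R)²`, with `f_i ↔* g_i` inside the annulus and `f_i ↮* f_{i'}` for `i ≠ i'`. Cluster
separation is the form in which GM handle the alternating arm events (§8.2, modified events
`Ã_k`, `k = 2j ≥ 4`: "`x_i ↔ y_i` and `x_i ↮ x_{i'}` for `i ≠ i'`"; `k = 2`: "`x_1 ↔ y_1` and
`x_1^* ↔* y_1^*`"; there with connections in the whole graph plus side conditions tying the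
clusters to a box, here with connections inside the annulus, which is what the event `A_{2j}`
of §3 itself amounts to): "`2j` arms of alternating colours in cyclic order" is equivalent to
the present event because, for `j ≥ 2`, consecutive distinct crossing clusters of the annulus
are separated by dual-open crossings (planar duality), and conversely cyclically alternating
arms of one colour are separated by those of the other colour, which they cannot cross; for
`j = 1` both sides read "one open and one dual-open crossing". The dual clause is thus
redundant for `j ≥ 2` and essential for `j = 1`. Slack conventions (`2`, bounding primal and dual edge lengths) are those
of `RhombicEmbedding.embArmEvent`; for `j = 0` the event is `Set.univ`.
[cite: GrimmettManolescu2014Isoradial, §3 (A_{2j}) and §8.2 (modified arm events)] -/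
def _root_.Literature.Probability.LatticeModels.RhombicEmbedding.embAltArmEvent (j r R : ℕ) :
    Set (BondConfig V) :=
  {ω | (∃ x y : Fin j → V,
      (∀ i, (emb.z (x i)).boxNorm ≤ r ∧ (R : ℝ) ≤ (emb.z (y i)).boxNorm ∧
        ω ∈ openConnIn (annulusPts emb.z r R) (x i) (y i)) ∧
      Pairwise fun i i' => ω ∉ openConnIn (annulusPts emb.z r R) (x i) (x i')) ∧
    (∃ f g : Fin j → F,
      (∀ i, (emb.c (f i)).boxNorm ≤ r ∧ (R : ℝ) ≤ (emb.c (g i)).boxNorm ∧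
        emb.dualConnIn ω (annulusPts emb.c r R) (f i) (g i)) ∧
      Pairwise fun i i' => ¬ emb.dualConnIn ω (annulusPts emb.c r R) (f i) (f i'))}

/-- With no arms required the event is sure (standard convention, as for `embArmEvent`).
[folklore] -/
theorem _root_.Literature.Probability.LatticeModels.RhombicEmbedding.embAltArmEvent_zero
    (r R : ℕ) : emb.embAltArmEvent 0 r R = Set.univ := by
  ext ω
  simp only [RhombicEmbedding.embAltArmEvent, Set.mem_setOf_eq, Set.mem_univ, iff_true]
  exact ⟨⟨Fin.elim0, Fin.elim0, fun i => i.elim0, fun i => i.elim0⟩,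
    ⟨Fin.elim0, Fin.elim0, fun i => i.elim0, fun i => i.elim0⟩⟩

/-- In a walk, every vertex of the support is reached from the start by a sub-walk whose
support is contained in that of the walk (Mathlib `Walk.takeUntil`). [folklore] -/
private theorem exists_walk_support_subset_of_mem {H : SimpleGraph V} {u v w : V}
    (p : H.Walk u v) (hw : w ∈ p.support) :
    ∃ q : H.Walk u w, ∀ a ∈ q.support, a ∈ p.support := by
  classical
  exact ⟨p.takeUntil w hw, fun a ha => p.support_takeUntil_subset_support hw ha⟩

/-- Two walks with all vertices in `S` whose supports share a vertex have start points joined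
inside `S`. [folklore] -/
private theorem exists_walk_of_not_disjoint {H : SimpleGraph V} {S : Set V} {u v u' v' : V}
    (p : H.Walk u v) (p' : H.Walk u' v') (hp : ∀ a ∈ p.support, a ∈ S)
    (hp' : ∀ a ∈ p'.support, a ∈ S)
    (h : ¬ Disjoint {a | a ∈ p.support} {a | a ∈ p'.support}) :
    ∃ q : H.Walk u u', ∀ a ∈ q.support, a ∈ S := by
  rw [Set.not_disjoint_iff] at h
  obtain ⟨w, hw, hw'⟩ := h
  obtain ⟨q, hq⟩ := exists_walk_support_subset_of_mem p hw
  obtain ⟨q', hq'⟩ := exists_walk_support_subset_of_mem p' hw'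
  refine ⟨q.append q'.reverse, fun a ha => ?_⟩
  rw [SimpleGraph.Walk.mem_support_append_iff, SimpleGraph.Walk.support_reverse,
    List.mem_reverse] at ha
  rcases ha with ha | ha
  · exact hp a (hq a ha)
  · exact hp' a (hq' a ha)

/-- The index of the crossing cluster carrying arm `i` of the `2j` alternating arms: arms `2m`
(primal) and `2m + 1` (dual) both come from the `m`-th pair. [folklore] -/
private def halfIndex {j : ℕ} (i : Fin (2 * j)) : Fin j :=
  ⟨(i : ℕ) / 2, by have := i.2; omega⟩

/-- **The cluster-separated event refines the prelude's event.** Every configuration in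
`embAltArmEvent j r R` lies in `embArmEvent κ r R` for the alternating colour sequence
`κ i = decide (Even i)` on `Fin (2 * j)` (arm `i` primal-open iff `i` is even; this is
`alternatingColours j` of `Isoradial.lean`, written out because that file imports the present
one): crossings in distinct (dual) clusters of the annulus are in particular vertex-disjoint.
The converse fails for `j ≥ 2` (module docstring; `IsoradialPrintedArms`,
`embAltArmEvent_two_ssubset_embArmEvent`).
[cite: GrimmettManolescu2014Isoradial, §3 (A_{2j}: arms in anticlockwise order)] -/
theorem _root_.Literature.Probability.LatticeModels.RhombicEmbedding.embAltArmEvent_subset_embArmEvent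
    (j r R : ℕ) :
    emb.embAltArmEvent j r R ⊆
      emb.embArmEvent (fun i : Fin (2 * j) => decide (Even (i : ℕ))) r R := by
  rintro ω ⟨⟨x, y, hxy, hsep⟩, ⟨f, g, hfg, hsep'⟩⟩
  -- primal crossings as open walks supported in the annulus
  have hP : ∀ i, ∃ w : (openGraph ω).Walk (x i) (y i),
      ∀ v ∈ w.support, v ∈ annulusPts emb.z r R := fun i =>
    mem_openConnIn_iff_exists_openWalk'.1 (hxy i).2.2
  choose w hw using hP
  -- dual crossings as dual-open walks supported in the annulus
  have hD : ∀ i, ∃ w' : (emb.dualOpenGraph ω).Walk (f i) (g i),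
      ∀ v ∈ w'.support, v ∈ annulusPts emb.c r R := fun i =>
    (emb.dualConnIn_iff_exists_walk ω _ _ _).1 (hfg i).2.2
  choose w' hw' using hD
  refine ⟨fun i => x (halfIndex i), fun i => y (halfIndex i), fun i => w (halfIndex i),
    fun i => f (halfIndex i), fun i => g (halfIndex i), fun i => w' (halfIndex i),
    fun i _ => ⟨(hxy _).1, (hxy _).2.1, fun v hv => hw _ v hv⟩,
    fun i _ => ⟨(hfg _).1, (hfg _).2.1, fun v hv => hw' _ v hv⟩, ?_, ?_⟩
  · intro i i' hii' hi hi'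
    have hne : halfIndex i ≠ halfIndex i' := by
      intro h
      have h1 : (i : ℕ) % 2 = 0 := Nat.even_iff.1 (of_decide_eq_true hi)
      have h2 : (i' : ℕ) % 2 = 0 := Nat.even_iff.1 (of_decide_eq_true hi')
      have h3 : (i : ℕ) / 2 = (i' : ℕ) / 2 := congrArg Fin.val h
      exact hii' (Fin.ext (by omega))
    by_contra hdis
    obtain ⟨q, hq⟩ := exists_walk_of_not_disjoint (w (halfIndex i)) (w (halfIndex i'))
      (hw _) (hw _) hdis
    exact hsep hne (mem_openConnIn_iff_exists_openWalk'.2 ⟨q, hq⟩)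
  · intro i i' hii' hi hi'
    have hne : halfIndex i ≠ halfIndex i' := by
      intro h
      have h1 : ¬ (i : ℕ) % 2 = 0 := fun h1 => by
        have := of_decide_eq_false hi; exact this (Nat.even_iff.2 h1)
      have h2 : ¬ (i' : ℕ) % 2 = 0 := fun h2 => by
        have := of_decide_eq_false hi'; exact this (Nat.even_iff.2 h2)
      have h3 : (i : ℕ) / 2 = (i' : ℕ) / 2 := congrArg Fin.val h
      exact hii' (Fin.ext (by omega))
    by_contra hdis
    obtain ⟨q, hq⟩ := exists_walk_of_not_disjoint (w' (halfIndex i)) (w' (halfIndex i'))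
      (hw' _) (hw' _) hdis
    exact hsep' hne ((emb.dualConnIn_iff_exists_walk ω _ _ _).2 ⟨q, hq⟩)

end Dual

end Literature.Probability.Percolation
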